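import Literature.NumberTheory.Rogawski1990.ArchBouazizStableFamilyModel             -- ★ p850992 (LH3-p01 g4): the model package `exists_placeLeaves_stOrbFamH_model`, `contDiffOn_piLeafIntegral_inRegS`, `integral_unfoldIntegrand_eq_integral_integral`
import Literature.NumberTheory.Automorphic.ArchEndoscopicChartOrbUnfoldLeavesGiven      -- ★ (this seat, (JH-A) part 1): `exists_archRH_mul_chartOrbH_eq_of_placeLeaves_of_isHaarMeasure` (leaves GIVEN, `K₀` before `fH`), `exists_smul_map_descConj_quotientMeasure_of_eq`
import Literature.NumberTheory.Automorphic.ArchEndoscopicChartOrbLocalCongr            -- ★ (T-CONGR) (LH10-p02 g4): `endoBlockAt_eq_of_mem_iff`, `chartTorusHLoc_eq_of_mem_iff`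
import HarnessLib

/-!
# (JH-A) TWO-CHART LEAVES: ONE family of per-place leaves serving BOTH charts `S` (compact at `w₀ ∉ S`) and `insert w₀ S` (split at `w₀`), the quotient identity of the
# split leaf at `w₀`, and (a)(b)(c)(d) of ★ p850992 per chart — leaves and constants BEFORE the test function (L3′ (J)-H; Varadarajan §6.4, Shelstad §4, Bouaziz §3.1)

Topic `NumberTheory/Rogawski1990`; namespace `Literature.NumberTheory.Rogawski1990`.  THEOREMS ONLY (no `def`, no instance, no axiom, no `sorry`).  Cell `pub/hodgecm-mathlib`,
crux H413 (`stmt-HodgeConjecture-24833`), line LH3 (closer stub `stub_N9`, DIRECT ROAD), organ L3′ forward half (J)-H «ALL ORDERS, GENERAL fH» (the jump clause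
`ArchBzJump jcH (stOrbFamH L νH fH)`), brick **(JH-A)** of JH-SPEC v1∕v2 (LH3-p01 (g5), binder of record; dealer LH3-plan (g4) 11:47:46Z; consumers (JH-B) LH10-p01 (g5),
(JH-desc) LH3-p01, (JH-asm) LH3-p03 (g6)).  Author LH10-p02 (g7).  Count-neutral.

WHY.  The wall-normal jump of the stable family at a compact place `w₀ ∉ S` compares the chart `S` near a wall point with the ADJACENT split chart `insert w₀ S` near its
Cayley point; the jump constant is uniform in the wall point and in the test function ONLY IF both charts are unfolded against the SAME leaves at every spectator place
`w ≠ w₀` (the local chart data read the label only through `w ∈ S`, ★ (T-CONGR)).  ★ p850992 hides its leaves in an existential PER CHART; this file gives the two-chart package: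
* §1 **`stOrbFamH_eq_model_of_regS_identity`** — the (c)-step of ★ p850992 for ANY model function `I`: the unfolding identity on `RegS S` + `I ∈ C^∞(InRegS S)` ⇒
  `stOrbFamH = K₀ · E_S · Σ_{T ⊆ Sᶜ} I ∘ flipSet T` on `InRegS S` (★ `stOrbFamH_of_mem_regS`, cancellation of the compact factors, ★ `stOrbFamH_eq_of_tendsto` at the real walls);
* §2 **`exists_twoChart_placeLeaves_stOrbFamH_model`** — THE PACKAGE, binder order (B2) (leaves, constants, quotient identity BEFORE `fH`).  Construction: the `S`-leaves
  of ★ `exists_placeLeaf_explicit` at every place; at `w₀` the split leaf of ★ `exists_placeLeaf_explicit (insert w₀ S) w₀` (`Function.update`); the per-place leaf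
  identities off `w₀` TRANSPORTED to the local data of `insert w₀ S` by ★ `exists_smul_map_descConj_quotientMeasure_of_eq` (one Haar scalar per place, absorbed into
  `C_w′`); (a) per chart by ★ `exists_archRH_mul_chartOrbH_eq_of_placeLeaves_of_isHaarMeasure`; (b) ★ `contDiffOn_piLeafIntegral_inRegS`; (c) §1; (d) ★
  `integral_unfoldIntegrand_eq_integral_integral`.
HONEST LABEL: HC_CM is proved only modulo the 7 printed citations (2 remaining: hLiu418 = stmt-HodgeConjecture-24832, h413 = stmt-HodgeConjecture-24833) until rung 0 closes;
measure-theoretic bookkeeping for the (J)-H jump, pays nothing by itself.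

## References
* [Varadarajan1989] V. S. Varadarajan, *An Introduction to Harmonic Analysis on Semisimple Lie Groups* (1989), §6.4 Lemma 21, Thm 23.
* [Shelstad1979] D. Shelstad, *Characters and inner forms of a quasi-split group over ℝ*, Compositio Math. 39 (1979), §4 pp. 22–25.
* [Bouaziz1994IntegralesOrbitales] A. Bouaziz, *Intégrales orbitales sur les algèbres de Lie réductives*, Invent. Math. 115 (1994), §3.1 p. 579; §6.2 p. 591.
* [Folland1995] G. B. Folland, *A Course in Abstract Harmonic Analysis* (1995), §2.6 (2.52); [DeitmarEchterhoff2014] Thm. 1.5.3; [Rogawski1990] §4.1 (4.1.1) p. 39, §8.2 pp. 119–122.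
-/

set_option autoImplicit false

noncomputable section

open MeasureTheory Measure Filter Topology Set Function NumberField NumberField.InfinitePlace Matrix Complex
open Literature.NumberTheory.Automorphic Literature.NumberTheory.Automorphic.UnitaryGroup Literature.NumberTheory.Automorphic.ArchCartan
open Literature.MeasureTheory.Group
open scoped ContDiff Classical MatrixGroups Matrix ENNReal NNReal

namespace Literature.NumberTheory.Rogawski1990

local notation3 "Φ₂[" L "]" => (Matrix.of fun i j : Fin 2 => if i.val + j.val + 1 = 2 then (1 : L) else 0)
local notation3 "Φ₁[" L "]" => (Matrix.of fun i j : Fin 1 => if i.val + j.val + 1 = 1 then (1 : L) else 0)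
local notation3 "𝔸[" L "]" => ↥(arch (↥(maximalRealSubfield L)) L (IsCMField.complexConj L) 2 Φ₂[L])
local notation3 "𝔹[" L "]" => ↥(arch (↥(maximalRealSubfield L)) L (IsCMField.complexConj L) 1 Φ₁[L])

/-! ## §1 The model identity on `InRegS S` from the unfolding identity on `RegS S` and smoothness (the (c)-step of ★ p850992, for any `I`) -/

section ModelStep
variable (L : Type) [Field L] [NumberField L] [IsCMField L] (S : Finset {w : InfinitePlace L // IsComplex w})
  [MeasurableSpace 𝔸[L]] [BorelSpace 𝔸[L]] [MeasurableSpace 𝔹[L]] [BorelSpace 𝔹[L]]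
  (νH : Measure (𝔸[L] × 𝔹[L])) [νH.IsHaarMeasure] [νH.IsMulRightInvariant]

/-- **THE MODEL OF THE STABLE FAMILY FROM THE UNFOLDING IDENTITY** (the (c)-step of ★ `exists_placeLeaves_stOrbFamH_model`, for ANY function `I`): if
`archRH S c · chartOrbH L νH S fH c = K₀ · E_S(c) · I(c)` on `RegS S` and `I ∈ C^∞(InRegS S)`, then `stOrbFamH L νH fH S c = K₀ · E_S(c) · Σ_{T ⊆ Sᶜ} I(flipSet T c)` for EVERY
`c ∈ InRegS S` (on `RegS S` by the literal reading ★ `stOrbFamH_of_mem_regS` and the cancellation of the compact factors of `archRH`∕`E_S` under `flipSet`; at the real walls by ★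
`stOrbFamH_eq_of_tendsto` and continuity of the model). [cite: Varadarajan1989, §6.4 Thm 23] [cite: Bouaziz1994IntegralesOrbitales, §3.1 p. 579; §6.2 p. 591]
[cite: Rogawski1990, §4.1 (4.1.1) p. 39] -/
theorem stOrbFamH_eq_model_of_regS_identity (fH : 𝔸[L] × 𝔹[L] → ℂ) (I : ({w : InfinitePlace L // IsComplex w} → Fin 3 → ℝ) → ℂ) (K₀ : ℝ)
    (hid : ∀ c : {w : InfinitePlace L // IsComplex w} → Fin 3 → ℝ, c ∈ RegS S →
      archRH S c * chartOrbH L νH S fH c = (K₀ : ℂ) * (∏ w, (if w ∈ S then ((Real.exp (c w 0) : ℝ) : ℂ) else 1 - (Circle.exp (c w 2 - c w 0) : ℂ))) * I c)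
    (hI : ContDiffOn ℝ ∞ I (InRegS S)) :
    ∀ c : {w : InfinitePlace L // IsComplex w} → Fin 3 → ℝ, c ∈ InRegS S →
      stOrbFamH L νH fH S c =
        (K₀ : ℂ) * (∏ w, (if w ∈ S then ((Real.exp (c w 0) : ℝ) : ℂ) else 1 - (Circle.exp (c w 2 - c w 0) : ℂ))) * ∑ T ∈ (Finset.univ \ S).powerset, I (flipSet T c) := by
  -- the smooth model `G`
  obtain ⟨G, hG_def⟩ : ∃ G : ({w : InfinitePlace L // IsComplex w} → Fin 3 → ℝ) → ℂ, G = fun c =>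
      (K₀ : ℂ) * (∏ w, (if w ∈ S then ((Real.exp (c w 0) : ℝ) : ℂ) else 1 - (Circle.exp (c w 2 - c w 0) : ℂ))) *
        ∑ T ∈ (Finset.univ \ S).powerset, I (flipSet T c) := ⟨_, rfl⟩
  have hG : ContDiffOn ℝ ∞ G (InRegS S) := by
    rw [hG_def]
    refine (contDiffOn_const.mul (contDiff_expFactor S).contDiffOn).mul (ContDiffOn.sum fun T _ => ?_)
    exact hI.comp (contDiff_flipSet T).contDiffOn fun c hc => (flipSet_mem_inRegS_iff S T c).2 hc
  -- on `RegS S` the family IS `G`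
  have hreg : ∀ c ∈ RegS S, stOrbFamH L νH fH S c = G c := by
    intro c hc
    rw [stOrbFamH_of_mem_regS L νH fH S hc, hG_def]
    simp only
    rw [Finset.mul_sum, Finset.mul_sum]
    refine Finset.sum_congr rfl fun T hT => ?_
    have hTS : ∀ w ∈ T, w ∉ S := not_mem_of_mem_powerset_sdiff hT
    have hcT : flipSet T c ∈ RegS S := (flipSet_mem_regS_iff S hTS c).2 hc
    have hcTI : flipSet T c ∈ InRegS S := regS_subset_inRegS S hcT
    have h := hid (flipSet T c) hcT
    rw [archRH_eq_splitFactor_mul_cptFactor, expFactor_eq_splitFactor_mul_cptFactor,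
      splitFactor_flipSet S hTS (fun x => ((|Real.exp x - Real.exp (-x)| : ℝ) : ℂ)), splitFactor_flipSet S hTS (fun x => ((Real.exp x : ℝ) : ℂ))] at h
    have hne := cptFactor_ne_zero_of_mem_inRegS S hcTI
    have h' : (∏ w, (if w ∈ S then ((|Real.exp (c w 0) - Real.exp (-c w 0)| : ℝ) : ℂ) else 1)) * chartOrbH L νH S fH (flipSet T c) =
        (K₀ : ℂ) * (∏ w, (if w ∈ S then ((Real.exp (c w 0) : ℝ) : ℂ) else 1)) * I (flipSet T c) := by
      have h2 : (∏ w, (if w ∈ S then (1 : ℂ) else 1 - (Circle.exp (flipSet T c w 2 - flipSet T c w 0) : ℂ))) *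
          ((∏ w, (if w ∈ S then ((|Real.exp (c w 0) - Real.exp (-c w 0)| : ℝ) : ℂ) else 1)) * chartOrbH L νH S fH (flipSet T c)) =
          (∏ w, (if w ∈ S then (1 : ℂ) else 1 - (Circle.exp (flipSet T c w 2 - flipSet T c w 0) : ℂ))) *
          ((K₀ : ℂ) * (∏ w, (if w ∈ S then ((Real.exp (c w 0) : ℝ) : ℂ) else 1)) * I (flipSet T c)) := by
        calc _ = (∏ w, (if w ∈ S then ((|Real.exp (c w 0) - Real.exp (-c w 0)| : ℝ) : ℂ) else 1)) *
              (∏ w, (if w ∈ S then (1 : ℂ) else 1 - (Circle.exp (flipSet T c w 2 - flipSet T c w 0) : ℂ))) * chartOrbH L νH S fH (flipSet T c) := by ring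
          _ = _ := by rw [h]; ring
      exact mul_left_cancel₀ hne h2
    rw [archRH_eq_splitFactor_mul_cptFactor, expFactor_eq_splitFactor_mul_cptFactor]
    calc (∏ w, (if w ∈ S then ((|Real.exp (c w 0) - Real.exp (-c w 0)| : ℝ) : ℂ) else 1)) *
          (∏ w, (if w ∈ S then (1 : ℂ) else 1 - (Circle.exp (c w 2 - c w 0) : ℂ))) * chartOrbH L νH S fH (flipSet T c)
        = (∏ w, (if w ∈ S then (1 : ℂ) else 1 - (Circle.exp (c w 2 - c w 0) : ℂ))) *
          ((∏ w, (if w ∈ S then ((|Real.exp (c w 0) - Real.exp (-c w 0)| : ℝ) : ℂ) else 1)) * chartOrbH L νH S fH (flipSet T c)) := by ring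
      _ = _ := by rw [h']; ring
  -- at the real walls the family is the limit of `G` from `RegS S`
  intro c hc
  rw [show (K₀ : ℂ) * (∏ w, (if w ∈ S then ((Real.exp (c w 0) : ℝ) : ℂ) else 1 - (Circle.exp (c w 2 - c w 0) : ℂ))) *
      ∑ T ∈ (Finset.univ \ S).powerset, I (flipSet T c) = G c by rw [hG_def]]
  by_cases hcR : c ∈ RegS S
  · exact hreg c hcR
  · refine stOrbFamH_eq_of_tendsto L νH fH S hc hcR (mem_closure_regS S c) ?_
    have hcont : ContinuousAt G c := (hG.continuousOn.continuousWithinAt hc).continuousAt ((isOpen_inRegS S).mem_nhds hc)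
    refine (hcont.tendsto.mono_left nhdsWithin_le_nhds).congr' ?_
    filter_upwards [self_mem_nhdsWithin] with c' hc'
    rw [← hreg c' hc', stOrbFamH_of_mem_regS L νH fH S hc', stableSum_def]
end ModelStep

/-! ## §2 (JH-A) THE TWO-CHART PACKAGE -/

section TwoCharts
variable (L : Type) [Field L] [NumberField L] [IsCMField L] (S : Finset {w : InfinitePlace L // IsComplex w}) (w₀ : {w : InfinitePlace L // IsComplex w})
  [∀ w : {w : InfinitePlace L // IsComplex w}, MeasurableSpace ↥(archLocal L 2 Φ₂[L] w)]
  [∀ w : {w : InfinitePlace L // IsComplex w}, BorelSpace ↥(archLocal L 2 Φ₂[L] w)]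
  [MeasurableSpace 𝔸[L]] [BorelSpace 𝔸[L]] [MeasurableSpace 𝔹[L]] [BorelSpace 𝔹[L]]
  (νH : Measure (𝔸[L] × 𝔹[L])) [νH.IsHaarMeasure] [νH.IsMulRightInvariant]

set_option maxHeartbeats 800000 in
/-- **(JH-A) TWO-CHART LEAVES.**  For `w₀ ∉ S` and a Haar measure `νH` on `H_∞`: Haar measures `ν_w`, constants `K₀, K₀′`, TWO families of per-place leaves `(Λ_w, Z_w)`
(chart `S`, compact at `w₀`) and `(Λ′_w, Z′_w)` (chart `insert w₀ S`, split at `w₀`) which COINCIDE at every `w ≠ w₀`, and `C′ ≠ 0` — ALL CHOSEN BEFORE THE TEST FUNCTION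
(JH v2 (R-A), binder order (B2)) — with: ★ (α1)'s measure-theoretic clauses for each chart (finite on compacta, σ-finite, closed carrying leaves, explicit compact leaves
`(g ↦ (g,1))_* ν_w`, uniform properness); at `w₀` on the split chart the QUOTIENT IDENTITY of `Λ′_{w₀}` (★ `exists_placeLeaf`'s clause:
`(descConj γ T′)_* (ν_{w₀} ∕ dt′) = (C′ · ‖e^{−2x} − 1‖⁻¹) • (z ↦ z₁ γ z₂ z₁⁻¹)_* Λ′_{w₀}`, `γ = endoBlockAt (insert w₀ S) w₀ (c w₀)`, `x = c w₀ 0 ≠ 0`, `T′ = chartTorusHLoc (insert w₀ S) w₀`,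
`dt′ =` ★ `chartHaarHLoc`); then, for EVERY `fH ∈ C_c^∞(H_∞)`, clauses (a)(b)(c)(d) of ★ `exists_placeLeaves_stOrbFamH_model` for the chart `S` with `(K₀, Λ_w)` AND for
`insert w₀ S` with `(K₀′, Λ′_w)`. [cite: Varadarajan1989, §6.4 Lemma 21, Thm 23] [cite: Shelstad1979, §4 pp. 22–25] [cite: Bouaziz1994IntegralesOrbitales, §3.1 p. 579; §6.2 p. 591]
[cite: Folland1995, §2.6 (2.52)] [cite: DeitmarEchterhoff2014, Thm. 1.5.3] [cite: Rogawski1990, §4.1 (4.1.1) p. 39; §8.2 pp. 119–122] -/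
theorem exists_twoChart_placeLeaves_stOrbFamH_model (hw₀ : w₀ ∉ S) :
    ∃ (νw : ∀ w : {w : InfinitePlace L // IsComplex w}, Measure ↥(archLocal L 2 Φ₂[L] w)) (hνH : ∀ w, (νw w).IsHaarMeasure) (hνR : ∀ w, (νw w).IsMulRightInvariant)
      (K₀ K₀' : ℝ)
      (Λw Λw' : ∀ w : {w : InfinitePlace L // IsComplex w}, Measure (↥(archLocal L 2 Φ₂[L] w) × ↥(archLocal L 2 Φ₂[L] w)))
      (Zw Zw' : ∀ w : {w : InfinitePlace L // IsComplex w}, Set (↥(archLocal L 2 Φ₂[L] w) × ↥(archLocal L 2 Φ₂[L] w))) (C' : ℝ≥0),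
      -- ══ SHARED LEAVES OFF `w₀`
      (∀ w, w ≠ w₀ → Λw' w = Λw w) ∧ (∀ w, w ≠ w₀ → Zw' w = Zw w) ∧
      -- ══ CHART `S` (compact at `w₀`): the measure-theoretic clauses of ★ (α1) for `(Λw, Zw)`
      ((∀ w, IsFiniteMeasureOnCompacts (Λw w)) ∧ (∀ w, SigmaFinite (Λw w)) ∧ (∀ w, IsClosed (Zw w)) ∧ (∀ w, Λw w (Zw w)ᶜ = 0) ∧
      (∀ w, w ∉ S → Λw w = Measure.map (fun g : ↥(archLocal L 2 Φ₂[L] w) => (g, (1 : ↥(archLocal L 2 Φ₂[L] w)))) (νw w)) ∧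
      (∀ (w) (U : Set ({w : InfinitePlace L // IsComplex w} → Fin 3 → ℝ)), IsCompact U → (w ∉ S → ∀ c ∈ U, Circle.exp (c w 0) ≠ Circle.exp (c w 2)) →
        ∀ C'' : Set ↥(archLocal L 2 Φ₂[L] w), IsCompact C'' →
          ∃ 𝒮 : Set (↥(archLocal L 2 Φ₂[L] w) × ↥(archLocal L 2 Φ₂[L] w)), IsCompact 𝒮 ∧
            ∀ z ∈ Zw w, ∀ c ∈ U, z.1 * (endoBlockAt L S w (c w) * z.2) * z.1⁻¹ ∈ C'' → z ∈ 𝒮)) ∧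
      -- ══ CHART `insert w₀ S` (split at `w₀`): the same for `(Λw', Zw')`
      ((∀ w, IsFiniteMeasureOnCompacts (Λw' w)) ∧ (∀ w, SigmaFinite (Λw' w)) ∧ (∀ w, IsClosed (Zw' w)) ∧ (∀ w, Λw' w (Zw' w)ᶜ = 0) ∧
      (∀ w, w ∉ insert w₀ S → Λw' w = Measure.map (fun g : ↥(archLocal L 2 Φ₂[L] w) => (g, (1 : ↥(archLocal L 2 Φ₂[L] w)))) (νw w)) ∧
      (∀ (w) (U : Set ({w : InfinitePlace L // IsComplex w} → Fin 3 → ℝ)), IsCompact U → (w ∉ insert w₀ S → ∀ c ∈ U, Circle.exp (c w 0) ≠ Circle.exp (c w 2)) →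
        ∀ C'' : Set ↥(archLocal L 2 Φ₂[L] w), IsCompact C'' →
          ∃ 𝒮 : Set (↥(archLocal L 2 Φ₂[L] w) × ↥(archLocal L 2 Φ₂[L] w)), IsCompact 𝒮 ∧
            ∀ z ∈ Zw' w, ∀ c ∈ U, z.1 * (endoBlockAt L (insert w₀ S) w (c w) * z.2) * z.1⁻¹ ∈ C'' → z ∈ 𝒮)) ∧
      -- ══ THE QUOTIENT IDENTITY OF THE SPLIT LEAF `Λw' w₀` (★ `exists_placeLeaf`'s clause at the split place `w₀ ∈ insert w₀ S`)
      C' ≠ 0 ∧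
      (∀ c : {w : InfinitePlace L // IsComplex w} → Fin 3 → ℝ, c w₀ 0 ≠ 0 →
        (haveI := locallyCompactSpace_archLocal_two L w₀
         haveI := secondCountableTopology_archLocal_two L w₀
         haveI : (νw w₀).IsHaarMeasure := hνH w₀
         haveI : (νw w₀).IsMulRightInvariant := hνR w₀
         haveI := isHaarMeasure_chartHaarHLoc L (insert w₀ S) w₀
         haveI := isInvInvariant_chartHaarHLoc L (insert w₀ S) w₀
         letI : MeasurableSpace (↥(archLocal L 2 Φ₂[L] w₀) ⧸ chartTorusHLoc L (insert w₀ S) w₀) := borel _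
         haveI : BorelSpace (↥(archLocal L 2 Φ₂[L] w₀) ⧸ chartTorusHLoc L (insert w₀ S) w₀) := ⟨rfl⟩
         Measure.map (descConj (endoBlockAt L (insert w₀ S) w₀ (c w₀)) (chartTorusHLoc L (insert w₀ S) w₀)
             (forall_mem_chartTorusHLoc_comm L (insert w₀ S) w₀ (c w₀)) id)
           (quotientMeasure (chartTorusHLoc L (insert w₀ S) w₀) (chartHaarHLoc L (insert w₀ S) w₀) (isClosed_chartTorusHLoc L (insert w₀ S) w₀) (νw w₀))) =
          (C' * ‖(((Real.exp (-2 * c w₀ 0) : ℝ) : ℂ)) - 1‖₊⁻¹) •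
            Measure.map (fun z : ↥(archLocal L 2 Φ₂[L] w₀) × ↥(archLocal L 2 Φ₂[L] w₀) => z.1 * (endoBlockAt L (insert w₀ S) w₀ (c w₀) * z.2) * z.1⁻¹) (Λw' w₀)) ∧
      -- ══ FOR EVERY TEST FUNCTION: (a)(b)(c)(d) of ★ p850992, chart `S` with `(K₀, Λw)` and chart `insert w₀ S` with `(K₀', Λw')`
      ∀ {fH : 𝔸[L] × 𝔹[L] → ℂ}, ArchSmooth₂ L fH →
        ((∀ c : {w : InfinitePlace L // IsComplex w} → Fin 3 → ℝ, c ∈ RegS S →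
          archRH S c * chartOrbH L νH S fH c =
            (K₀ : ℂ) * (∏ w, (if w ∈ S then ((Real.exp (c w 0) : ℝ) : ℂ) else 1 - (Circle.exp (c w 2 - c w 0) : ℂ))) *
              ∫ z, fH ((archPiEquivCM 2 L Φ₂[L]).symm (fun w => (z w).1 * (endoBlockAt L S w (c w) * (z w).2) * (z w).1⁻¹), (endoTorus L S c).2) ∂(Measure.pi Λw)) ∧
        ContDiffOn ℝ ∞ (fun c : {w : InfinitePlace L // IsComplex w} → Fin 3 → ℝ =>
          ∫ z, fH ((archPiEquivCM 2 L Φ₂[L]).symm (fun w => (z w).1 * (endoBlockAt L S w (c w) * (z w).2) * (z w).1⁻¹), (endoTorus L S c).2) ∂(Measure.pi Λw))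
          (InRegS S) ∧
        (∀ c : {w : InfinitePlace L // IsComplex w} → Fin 3 → ℝ, c ∈ InRegS S →
          stOrbFamH L νH fH S c =
            (K₀ : ℂ) * (∏ w, (if w ∈ S then ((Real.exp (c w 0) : ℝ) : ℂ) else 1 - (Circle.exp (c w 2 - c w 0) : ℂ))) *
              ∑ T ∈ (Finset.univ \ S).powerset, ∫ z, fH ((archPiEquivCM 2 L Φ₂[L]).symm
                (fun w => (z w).1 * (endoBlockAt L S w (flipSet T c w) * (z w).2) * (z w).1⁻¹), (endoTorus L S (flipSet T c)).2) ∂(Measure.pi Λw)) ∧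
        (∀ (p : {w : InfinitePlace L // IsComplex w} → Prop) [DecidablePred p], (∀ w, p w → w ∉ S) →
          ∀ c : {w : InfinitePlace L // IsComplex w} → Fin 3 → ℝ, c ∈ InRegS S →
            (∫ z, fH ((archPiEquivCM 2 L Φ₂[L]).symm (fun w => (z w).1 * (endoBlockAt L S w (c w) * (z w).2) * (z w).1⁻¹), (endoTorus L S c).2)
                ∂(Measure.pi Λw)) =
              ∫ z' : ∀ w : {w : {w : InfinitePlace L // IsComplex w} // ¬ p w}, ↥(archLocal L 2 Φ₂[L] w.1) × ↥(archLocal L 2 Φ₂[L] w.1),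
                (∫ g : ∀ w : {w : {w : InfinitePlace L // IsComplex w} // p w}, ↥(archLocal L 2 Φ₂[L] w.1),
                  fH ((archPiEquivCM 2 L Φ₂[L]).symm (fun w => if h : p w then g ⟨w, h⟩ * endoBlockAt L S w (c w) * (g ⟨w, h⟩)⁻¹
                    else (z' ⟨w, h⟩).1 * (endoBlockAt L S w (c w) * (z' ⟨w, h⟩).2) * (z' ⟨w, h⟩).1⁻¹), (endoTorus L S c).2)
                  ∂(Measure.pi fun w : {w : {w : InfinitePlace L // IsComplex w} // p w} => νw w.1))
                ∂(Measure.pi fun w : {w : {w : InfinitePlace L // IsComplex w} // ¬ p w} => Λw w.1))) ∧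
        ((∀ c : {w : InfinitePlace L // IsComplex w} → Fin 3 → ℝ, c ∈ RegS (insert w₀ S) →
          archRH (insert w₀ S) c * chartOrbH L νH (insert w₀ S) fH c =
            (K₀' : ℂ) * (∏ w, (if w ∈ insert w₀ S then ((Real.exp (c w 0) : ℝ) : ℂ) else 1 - (Circle.exp (c w 2 - c w 0) : ℂ))) *
              ∫ z, fH ((archPiEquivCM 2 L Φ₂[L]).symm (fun w => (z w).1 * (endoBlockAt L (insert w₀ S) w (c w) * (z w).2) * (z w).1⁻¹), (endoTorus L (insert w₀ S) c).2) ∂(Measure.pi Λw')) ∧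
        ContDiffOn ℝ ∞ (fun c : {w : InfinitePlace L // IsComplex w} → Fin 3 → ℝ =>
          ∫ z, fH ((archPiEquivCM 2 L Φ₂[L]).symm (fun w => (z w).1 * (endoBlockAt L (insert w₀ S) w (c w) * (z w).2) * (z w).1⁻¹), (endoTorus L (insert w₀ S) c).2) ∂(Measure.pi Λw'))
          (InRegS (insert w₀ S)) ∧
        (∀ c : {w : InfinitePlace L // IsComplex w} → Fin 3 → ℝ, c ∈ InRegS (insert w₀ S) →
          stOrbFamH L νH fH (insert w₀ S) c =
            (K₀' : ℂ) * (∏ w, (if w ∈ insert w₀ S then ((Real.exp (c w 0) : ℝ) : ℂ) else 1 - (Circle.exp (c w 2 - c w 0) : ℂ))) *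
              ∑ T ∈ (Finset.univ \ insert w₀ S).powerset, ∫ z, fH ((archPiEquivCM 2 L Φ₂[L]).symm
                (fun w => (z w).1 * (endoBlockAt L (insert w₀ S) w (flipSet T c w) * (z w).2) * (z w).1⁻¹), (endoTorus L (insert w₀ S) (flipSet T c)).2) ∂(Measure.pi Λw')) ∧
        (∀ (p : {w : InfinitePlace L // IsComplex w} → Prop) [DecidablePred p], (∀ w, p w → w ∉ insert w₀ S) →
          ∀ c : {w : InfinitePlace L // IsComplex w} → Fin 3 → ℝ, c ∈ InRegS (insert w₀ S) →
            (∫ z, fH ((archPiEquivCM 2 L Φ₂[L]).symm (fun w => (z w).1 * (endoBlockAt L (insert w₀ S) w (c w) * (z w).2) * (z w).1⁻¹), (endoTorus L (insert w₀ S) c).2)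
                ∂(Measure.pi Λw')) =
              ∫ z' : ∀ w : {w : {w : InfinitePlace L // IsComplex w} // ¬ p w}, ↥(archLocal L 2 Φ₂[L] w.1) × ↥(archLocal L 2 Φ₂[L] w.1),
                (∫ g : ∀ w : {w : {w : InfinitePlace L // IsComplex w} // p w}, ↥(archLocal L 2 Φ₂[L] w.1),
                  fH ((archPiEquivCM 2 L Φ₂[L]).symm (fun w => if h : p w then g ⟨w, h⟩ * endoBlockAt L (insert w₀ S) w (c w) * (g ⟨w, h⟩)⁻¹
                    else (z' ⟨w, h⟩).1 * (endoBlockAt L (insert w₀ S) w (c w) * (z' ⟨w, h⟩).2) * (z' ⟨w, h⟩).1⁻¹), (endoTorus L (insert w₀ S) c).2)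
                  ∂(Measure.pi fun w : {w : {w : InfinitePlace L // IsComplex w} // p w} => νw w.1))
                ∂(Measure.pi fun w : {w : {w : InfinitePlace L // IsComplex w} // ¬ p w} => Λw' w.1))) := by
  haveI : ∀ w : {w : InfinitePlace L // IsComplex w}, LocallyCompactSpace ↥(archLocal L 2 Φ₂[L] w) := fun w => locallyCompactSpace_archLocal_two L w
  haveI : ∀ w : {w : InfinitePlace L // IsComplex w}, SecondCountableTopology ↥(archLocal L 2 Φ₂[L] w) := fun w => secondCountableTopology_archLocal_two L w
  -- Haar measures at the places (right invariant: the `U(Φ₂)_w` are unimodular)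
  obtain ⟨νw, hνw⟩ : ∃ νw : ∀ w : {w : InfinitePlace L // IsComplex w}, Measure ↥(archLocal L 2 Φ₂[L] w), ∀ w, (νw w).IsHaarMeasure :=
    ⟨fun w => Measure.haar, fun w => inferInstance⟩
  haveI : ∀ w, (νw w).IsHaarMeasure := hνw
  have hνr : ∀ w : {w : InfinitePlace L // IsComplex w}, (νw w).IsMulRightInvariant := fun w => by
    haveI : LocallyCompactSpace ↥(unitaryGroupOfForm (starRingEnd ℂ) ((Φ₂[L]).map w.1.embedding)) := locallyCompactSpace_archLocal_two L w
    have h1 : ∀ g : ↥(archLocal L 2 Φ₂[L] w), modularCharacterFun g = 1 := fun g =>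
      modularCharacterFun_eq_one_of_eq_over_antidiagonal_two (map_embedding_antidiagTwo_eq_over L w) g
    exact isMulRightInvariant_of_modularCharacterFun_eq_one (G := ↥(archLocal L 2 Φ₂[L] w)) h1 (νw w)
  haveI := hνr
  -- Borel structures on the quotients and the torus Haar measures, for BOTH charts
  letI : ∀ w : {w : InfinitePlace L // IsComplex w}, MeasurableSpace (↥(archLocal L 2 Φ₂[L] w) ⧸ chartTorusHLoc L S w) := fun w => borel _
  haveI : ∀ w : {w : InfinitePlace L // IsComplex w}, BorelSpace (↥(archLocal L 2 Φ₂[L] w) ⧸ chartTorusHLoc L S w) := fun w => ⟨rfl⟩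
  letI : ∀ w : {w : InfinitePlace L // IsComplex w}, MeasurableSpace (↥(archLocal L 2 Φ₂[L] w) ⧸ chartTorusHLoc L (insert w₀ S) w) := fun w => borel _
  haveI : ∀ w : {w : InfinitePlace L // IsComplex w}, BorelSpace (↥(archLocal L 2 Φ₂[L] w) ⧸ chartTorusHLoc L (insert w₀ S) w) := fun w => ⟨rfl⟩
  haveI : ∀ w, (chartHaarHLoc L S w).IsHaarMeasure := fun w => isHaarMeasure_chartHaarHLoc L S w
  haveI : ∀ w, (chartHaarHLoc L S w).IsInvInvariant := fun w => isInvInvariant_chartHaarHLoc L S w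
  haveI : ∀ w, (chartHaarHLoc L (insert w₀ S) w).IsHaarMeasure := fun w => isHaarMeasure_chartHaarHLoc L (insert w₀ S) w
  haveI : ∀ w, (chartHaarHLoc L (insert w₀ S) w).IsInvInvariant := fun w => isInvInvariant_chartHaarHLoc L (insert w₀ S) w
  -- membership bookkeeping
  have hmem : ∀ w : {w : InfinitePlace L // IsComplex w}, w ≠ w₀ → (w ∈ S ↔ w ∈ insert w₀ S) := fun w hw => by
    rw [Finset.mem_insert, or_iff_right hw]
  have hw₀' : w₀ ∈ insert w₀ S := Finset.mem_insert_self w₀ S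
  -- (1) the per-place leaves of the chart `S` (compact leaves explicit), and the split leaf at `w₀` of the chart `insert w₀ S`
  choose Λw Zw Cw hΛfin hZcl hZnull hCne hprop hexpl hleaf using fun w : {w : InfinitePlace L // IsComplex w} => exists_placeLeaf_explicit L S w (νw w)
  haveI : ∀ w, IsFiniteMeasureOnCompacts (Λw w) := hΛfin
  obtain ⟨Λ₀, Z₀, C₀, hΛ₀fin, hZ₀cl, hZ₀null, hC₀ne, hprop₀, -, hleaf₀⟩ := exists_placeLeaf_explicit L (insert w₀ S) w₀ (νw w₀)
  haveI := hΛ₀fin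
  -- (2) the second family: the `S`-leaves off `w₀`, the split leaf at `w₀`
  let Λw' : ∀ w : {w : InfinitePlace L // IsComplex w}, Measure (↥(archLocal L 2 Φ₂[L] w) × ↥(archLocal L 2 Φ₂[L] w)) := Function.update Λw w₀ Λ₀
  let Zw' : ∀ w : {w : InfinitePlace L // IsComplex w}, Set (↥(archLocal L 2 Φ₂[L] w) × ↥(archLocal L 2 Φ₂[L] w)) := Function.update Zw w₀ Z₀
  have hΛ'₀ : Λw' w₀ = Λ₀ := Function.update_self w₀ Λ₀ Λw
  have hZ'₀ : Zw' w₀ = Z₀ := Function.update_self w₀ Z₀ Zw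
  have hΛ'ne : ∀ w, w ≠ w₀ → Λw' w = Λw w := fun w hw => Function.update_of_ne hw Λ₀ Λw
  have hZ'ne : ∀ w, w ≠ w₀ → Zw' w = Zw w := fun w hw => Function.update_of_ne hw Z₀ Zw
  have hΛ'fin : ∀ w, IsFiniteMeasureOnCompacts (Λw' w) := by
    intro w
    by_cases hw : w = w₀
    · subst hw; rw [hΛ'₀]; exact hΛ₀fin
    · rw [hΛ'ne w hw]; exact hΛfin w
  haveI := hΛ'fin
  have hσ : ∀ w, SigmaFinite (Λw w) := fun w => inferInstance
  have hσ' : ∀ w, SigmaFinite (Λw' w) := fun w => inferInstance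
  have hZcl' : ∀ w, IsClosed (Zw' w) := by
    intro w
    by_cases hw : w = w₀
    · subst hw; rw [hZ'₀]; exact hZ₀cl
    · rw [hZ'ne w hw]; exact hZcl w
  have hZnull' : ∀ w, Λw' w (Zw' w)ᶜ = 0 := by
    intro w
    by_cases hw : w = w₀
    · subst hw; rw [hΛ'₀, hZ'₀]; exact hZ₀null
    · rw [hΛ'ne w hw, hZ'ne w hw]; exact hZnull w
  have hexpl' : ∀ w, w ∉ insert w₀ S → Λw' w = Measure.map (fun g : ↥(archLocal L 2 Φ₂[L] w) => (g, (1 : ↥(archLocal L 2 Φ₂[L] w)))) (νw w) := by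
    intro w hw
    rw [Finset.mem_insert, not_or] at hw
    rw [hΛ'ne w hw.1]
    exact hexpl w hw.2
  have hprop' : ∀ (w) (U : Set ({w : InfinitePlace L // IsComplex w} → Fin 3 → ℝ)), IsCompact U →
      (w ∉ insert w₀ S → ∀ c ∈ U, Circle.exp (c w 0) ≠ Circle.exp (c w 2)) →
      ∀ C'' : Set ↥(archLocal L 2 Φ₂[L] w), IsCompact C'' →
        ∃ 𝒮 : Set (↥(archLocal L 2 Φ₂[L] w) × ↥(archLocal L 2 Φ₂[L] w)), IsCompact 𝒮 ∧
          ∀ z ∈ Zw' w, ∀ c ∈ U, z.1 * (endoBlockAt L (insert w₀ S) w (c w) * z.2) * z.1⁻¹ ∈ C'' → z ∈ 𝒮 := by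
    intro w U hU hreg C'' hC''
    by_cases hw : w = w₀
    · subst hw; rw [hZ'₀]; exact hprop₀ U hU hreg C'' hC''
    · rw [hZ'ne w hw, ← endoBlockAt_eq_of_mem_iff L w (hmem w hw)]
      exact hprop w U hU (fun hwS => hreg fun h => hwS ((hmem w hw).2 h)) C'' hC''
  -- properness at the single points of `RegS` (the input form of the assembly)
  have hprop1 : ∀ (w) (c : {w : InfinitePlace L // IsComplex w} → Fin 3 → ℝ), c ∈ RegS S → ∀ C' : Set ↥(archLocal L 2 Φ₂[L] w), IsCompact C' →
      ∃ 𝒮 : Set (↥(archLocal L 2 Φ₂[L] w) × ↥(archLocal L 2 Φ₂[L] w)), IsCompact 𝒮 ∧ ∀ z ∈ Zw w, z.1 * (endoBlockAt L S w (c w) * z.2) * z.1⁻¹ ∈ C' → z ∈ 𝒮 := by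
    intro w c hc C' hC'
    obtain ⟨𝒮, h𝒮, h⟩ := hprop w {c} isCompact_singleton (fun hw c' hc' => by
      rw [Set.mem_singleton_iff.1 hc']; exact ((mem_regS_iff S c).1 hc).1 w hw) C' hC'
    exact ⟨𝒮, h𝒮, fun z hz hzC => h z hz c (Set.mem_singleton c) hzC⟩
  have hprop1' : ∀ (w) (c : {w : InfinitePlace L // IsComplex w} → Fin 3 → ℝ), c ∈ RegS (insert w₀ S) → ∀ C' : Set ↥(archLocal L 2 Φ₂[L] w), IsCompact C' →
      ∃ 𝒮 : Set (↥(archLocal L 2 Φ₂[L] w) × ↥(archLocal L 2 Φ₂[L] w)), IsCompact 𝒮 ∧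
        ∀ z ∈ Zw' w, z.1 * (endoBlockAt L (insert w₀ S) w (c w) * z.2) * z.1⁻¹ ∈ C' → z ∈ 𝒮 := by
    intro w c hc C' hC'
    obtain ⟨𝒮, h𝒮, h⟩ := hprop' w {c} isCompact_singleton (fun hw c' hc' => by
      rw [Set.mem_singleton_iff.1 hc']; exact ((mem_regS_iff (insert w₀ S) c).1 hc).1 w hw) C' hC'
    exact ⟨𝒮, h𝒮, fun z hz hzC => h z hz c (Set.mem_singleton c) hzC⟩
  -- (3) transport of the leaf identities off `w₀` to the local data of `insert w₀ S` (one scalar per place)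
  have hκ : ∀ w : {w : InfinitePlace L // IsComplex w}, ∃ κ : ℝ≥0, κ ≠ 0 ∧ (w ≠ w₀ →
      ∀ (γ γ' : ↥(archLocal L 2 Φ₂[L] w)) (_ : γ = γ') (hγ : ∀ m ∈ chartTorusHLoc L S w, m * γ = γ * m)
        (hγ' : ∀ m ∈ chartTorusHLoc L (insert w₀ S) w, m * γ' = γ' * m),
        Measure.map (descConj γ' (chartTorusHLoc L (insert w₀ S) w) hγ' id)
            (quotientMeasure (chartTorusHLoc L (insert w₀ S) w) (chartHaarHLoc L (insert w₀ S) w) (isClosed_chartTorusHLoc L (insert w₀ S) w) (νw w)) =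
          κ • Measure.map (descConj γ (chartTorusHLoc L S w) hγ id)
            (quotientMeasure (chartTorusHLoc L S w) (chartHaarHLoc L S w) (isClosed_chartTorusHLoc L S w) (νw w))) := by
    intro w
    by_cases hw : w = w₀
    · exact ⟨1, one_ne_zero, fun h => absurd hw h⟩
    · obtain ⟨κ, hκ, h⟩ := exists_smul_map_descConj_quotientMeasure_of_eq (νw w) (chartTorusHLoc_eq_of_mem_iff L w (hmem w hw))
        (isClosed_chartTorusHLoc L S w) (isClosed_chartTorusHLoc L (insert w₀ S) w) (chartHaarHLoc L S w) (chartHaarHLoc L (insert w₀ S) w)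
      exact ⟨κ, hκ, fun _ => h⟩
  choose κ hκne hκ using hκ
  let Cw' : {w : InfinitePlace L // IsComplex w} → ℝ≥0 := fun w => if w = w₀ then C₀ else κ w * Cw w
  have hC'₀ : Cw' w₀ = C₀ := if_pos rfl
  have hleaf' : ∀ (w) (c : {w : InfinitePlace L // IsComplex w} → Fin 3 → ℝ), (w ∈ insert w₀ S → c w 0 ≠ 0) →
      Measure.map (descConj (endoBlockAt L (insert w₀ S) w (c w)) (chartTorusHLoc L (insert w₀ S) w) (forall_mem_chartTorusHLoc_comm L (insert w₀ S) w (c w)) id)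
          (quotientMeasure (chartTorusHLoc L (insert w₀ S) w) (chartHaarHLoc L (insert w₀ S) w) (isClosed_chartTorusHLoc L (insert w₀ S) w) (νw w)) =
        (Cw' w * (if w ∈ insert w₀ S then ‖(((Real.exp (-2 * c w 0) : ℝ) : ℂ)) - 1‖₊⁻¹ else 1)) •
          Measure.map (fun z : ↥(archLocal L 2 Φ₂[L] w) × ↥(archLocal L 2 Φ₂[L] w) => z.1 * (endoBlockAt L (insert w₀ S) w (c w) * z.2) * z.1⁻¹) (Λw' w) := by
    intro w c hcw
    by_cases hw : w = w₀
    · subst hw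
      rw [hC'₀, hΛ'₀]
      exact hleaf₀ c hcw
    · have hγ : endoBlockAt L S w = endoBlockAt L (insert w₀ S) w := endoBlockAt_eq_of_mem_iff L w (hmem w hw)
      have hS : w ∈ S → c w 0 ≠ 0 := fun h => hcw ((hmem w hw).1 h)
      have h1 := hκ w hw (endoBlockAt L S w (c w)) (endoBlockAt L (insert w₀ S) w (c w)) (congrFun hγ (c w))
        (forall_mem_chartTorusHLoc_comm L S w (c w)) (forall_mem_chartTorusHLoc_comm L (insert w₀ S) w (c w))
      have hCw : Cw' w = κ w * Cw w := if_neg hw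
      have hif : (if w ∈ insert w₀ S then ‖(((Real.exp (-2 * c w 0) : ℝ) : ℂ)) - 1‖₊⁻¹ else (1 : ℝ≥0)) =
          (if w ∈ S then ‖(((Real.exp (-2 * c w 0) : ℝ) : ℂ)) - 1‖₊⁻¹ else 1) := by
        by_cases h : w ∈ S
        · rw [if_pos h, if_pos ((hmem w hw).1 h)]
        · rw [if_neg h, if_neg (fun h' => h ((hmem w hw).2 h'))]
      rw [h1, hleaf w c hS, hCw, hif, hΛ'ne w hw, smul_smul, ← hγ, mul_assoc]
  -- (4) the unfolding identities (a) for both charts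
  obtain ⟨K₀, hid⟩ := exists_archRH_mul_chartOrbH_eq_of_placeLeaves_of_isHaarMeasure L S νw νH Λw Zw hZnull Cw hprop1 hleaf
  obtain ⟨K₀', hid'⟩ := exists_archRH_mul_chartOrbH_eq_of_placeLeaves_of_isHaarMeasure L (insert w₀ S) νw νH Λw' Zw' hZnull' Cw' hprop1' hleaf'
  -- (5) assemble the test-function-free part; then, per test function, smoothness (b), the model (c), the Fubini form (d) for each chart
  refine ⟨νw, hνw, hνr, K₀, K₀', Λw, Λw', Zw, Zw', C₀, hΛ'ne, hZ'ne, ⟨hΛfin, hσ, hZcl, hZnull, hexpl, hprop⟩, ⟨hΛ'fin, hσ', hZcl', hZnull', hexpl', hprop'⟩, hC₀ne,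
    fun c hc0 => ?_, fun {fH} hfH => ?_⟩
  · have h := hleaf' w₀ c (fun _ => hc0)
    rw [hC'₀, if_pos hw₀'] at h
    exact h
  have hI : ContDiffOn ℝ ∞ (fun c : {w : InfinitePlace L // IsComplex w} → Fin 3 → ℝ =>
      ∫ z, fH ((archPiEquivCM 2 L Φ₂[L]).symm (fun w => (z w).1 * (endoBlockAt L S w (c w) * (z w).2) * (z w).1⁻¹), (endoTorus L S c).2) ∂(Measure.pi Λw)) (InRegS S) :=
    contDiffOn_piLeafIntegral_inRegS L S hfH Λw Zw hZcl hZnull hprop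
  have hI' : ContDiffOn ℝ ∞ (fun c : {w : InfinitePlace L // IsComplex w} → Fin 3 → ℝ =>
      ∫ z, fH ((archPiEquivCM 2 L Φ₂[L]).symm (fun w => (z w).1 * (endoBlockAt L (insert w₀ S) w (c w) * (z w).2) * (z w).1⁻¹), (endoTorus L (insert w₀ S) c).2)
        ∂(Measure.pi Λw')) (InRegS (insert w₀ S)) :=
    contDiffOn_piLeafIntegral_inRegS L (insert w₀ S) hfH Λw' Zw' hZcl' hZnull' hprop'
  have hc := stOrbFamH_eq_model_of_regS_identity L S νH fH _ K₀ (hid fH hfH.continuous) hI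
  have hc' := stOrbFamH_eq_model_of_regS_identity L (insert w₀ S) νH fH _ K₀' (hid' fH hfH.continuous) hI'
  have hd : ∀ (p : {w : InfinitePlace L // IsComplex w} → Prop) [DecidablePred p], (∀ w, p w → w ∉ S) →
      ∀ c : {w : InfinitePlace L // IsComplex w} → Fin 3 → ℝ, c ∈ InRegS S →
        (∫ z, fH ((archPiEquivCM 2 L Φ₂[L]).symm (fun w => (z w).1 * (endoBlockAt L S w (c w) * (z w).2) * (z w).1⁻¹), (endoTorus L S c).2) ∂(Measure.pi Λw)) =
          ∫ z' : ∀ w : {w : {w : InfinitePlace L // IsComplex w} // ¬ p w}, ↥(archLocal L 2 Φ₂[L] w.1) × ↥(archLocal L 2 Φ₂[L] w.1),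
            (∫ g : ∀ w : {w : {w : InfinitePlace L // IsComplex w} // p w}, ↥(archLocal L 2 Φ₂[L] w.1),
              fH ((archPiEquivCM 2 L Φ₂[L]).symm (fun w => if h : p w then g ⟨w, h⟩ * endoBlockAt L S w (c w) * (g ⟨w, h⟩)⁻¹
                else (z' ⟨w, h⟩).1 * (endoBlockAt L S w (c w) * (z' ⟨w, h⟩).2) * (z' ⟨w, h⟩).1⁻¹), (endoTorus L S c).2)
              ∂(Measure.pi fun w : {w : {w : InfinitePlace L // IsComplex w} // p w} => νw w.1))
            ∂(Measure.pi fun w : {w : {w : InfinitePlace L // IsComplex w} // ¬ p w} => Λw w.1) := by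
    intro p _ hp c hc
    have hreg : ∀ w, w ∉ S → Circle.exp (c w 0) ≠ Circle.exp (c w 2) := (mem_inRegS_iff S c).1 hc
    refine integral_unfoldIntegrand_eq_integral_integral L S fH hfH.continuous (ArchSmooth₂.hasCompactSupport L hfH) Λw Zw hZcl hZnull νw p
      (fun w hw => hexpl w (hp w hw)) c (fun w C' hC' => ?_) (endoTorus L S c).2
    obtain ⟨𝒮, h𝒮, h⟩ := hprop w {c} isCompact_singleton (fun hw c' hc' => by rw [Set.mem_singleton_iff.1 hc']; exact hreg w hw) C' hC'
    exact ⟨𝒮, h𝒮, fun z hz hzC => h z hz c (Set.mem_singleton c) hzC⟩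
  have hd' : ∀ (p : {w : InfinitePlace L // IsComplex w} → Prop) [DecidablePred p], (∀ w, p w → w ∉ insert w₀ S) →
      ∀ c : {w : InfinitePlace L // IsComplex w} → Fin 3 → ℝ, c ∈ InRegS (insert w₀ S) →
        (∫ z, fH ((archPiEquivCM 2 L Φ₂[L]).symm (fun w => (z w).1 * (endoBlockAt L (insert w₀ S) w (c w) * (z w).2) * (z w).1⁻¹),
            (endoTorus L (insert w₀ S) c).2) ∂(Measure.pi Λw')) =
          ∫ z' : ∀ w : {w : {w : InfinitePlace L // IsComplex w} // ¬ p w}, ↥(archLocal L 2 Φ₂[L] w.1) × ↥(archLocal L 2 Φ₂[L] w.1),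
            (∫ g : ∀ w : {w : {w : InfinitePlace L // IsComplex w} // p w}, ↥(archLocal L 2 Φ₂[L] w.1),
              fH ((archPiEquivCM 2 L Φ₂[L]).symm (fun w => if h : p w then g ⟨w, h⟩ * endoBlockAt L (insert w₀ S) w (c w) * (g ⟨w, h⟩)⁻¹
                else (z' ⟨w, h⟩).1 * (endoBlockAt L (insert w₀ S) w (c w) * (z' ⟨w, h⟩).2) * (z' ⟨w, h⟩).1⁻¹), (endoTorus L (insert w₀ S) c).2)
              ∂(Measure.pi fun w : {w : {w : InfinitePlace L // IsComplex w} // p w} => νw w.1))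
            ∂(Measure.pi fun w : {w : {w : InfinitePlace L // IsComplex w} // ¬ p w} => Λw' w.1) := by
    intro p _ hp c hc
    have hreg : ∀ w, w ∉ insert w₀ S → Circle.exp (c w 0) ≠ Circle.exp (c w 2) := (mem_inRegS_iff (insert w₀ S) c).1 hc
    refine integral_unfoldIntegrand_eq_integral_integral L (insert w₀ S) fH hfH.continuous (ArchSmooth₂.hasCompactSupport L hfH) Λw' Zw' hZcl' hZnull' νw p
      (fun w hw => hexpl' w (hp w hw)) c (fun w C' hC' => ?_) (endoTorus L (insert w₀ S) c).2
    obtain ⟨𝒮, h𝒮, h⟩ := hprop' w {c} isCompact_singleton (fun hw c' hc' => by rw [Set.mem_singleton_iff.1 hc']; exact hreg w hw) C' hC'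
    exact ⟨𝒮, h𝒮, fun z hz hzC => h z hz c (Set.mem_singleton c) hzC⟩
  -- (6) assemble the per-test-function clauses
  exact ⟨⟨hid fH hfH.continuous, hI, hc, fun p _ hp c hcI => hd p hp c hcI⟩, ⟨hid' fH hfH.continuous, hI', hc', fun p _ hp c hcI => hd' p hp c hcI⟩⟩
end TwoCharts

end Literature.NumberTheory.Rogawski1990

end
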